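import Mathlib
import HarnessLib
import Summits.NavierStokesRegularity.NavierStokesRegularity.Theses.RootDecompPointVertex
import Literature.Analysis.FluidPDE.GigaMiura2011TypeIZoomKit
import Literature.Analysis.FluidPDE.NSCriticalClosureBesovBounded
import Literature.Analysis.FluidPDE.TaoLocalisationHolds
import Literature.Analysis.FluidPDE.TypeIAncientMild
import Literature.Analysis.FluidPDE.SpaceTimeRescaling

/-!
# `TypeITangentFlow` — crux TAN (rank 4) of route `RootDecompPointVertex` (N18), proved

Item stmt-NavierStokesRegularity-29914, a load-bearing binder of the route's `closes`:
EVERY TYPE-I BLOW-UP HAS A VERTEX BLOW-UP LIMIT IN THE TANGENT CLASS.  For `ν > 0` and a maximal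
smooth Leray–Hopf solution `(u, p)` of finite lifespan `T` from a rapidly decaying datum which blows
up at the Type-I rate at `T`, there are moving centres `xc k`, scales `lam k → 0⁺` and a field `U`
such that the viscosity-normalising vertex zooms `lam k • u (T + lam k² ν s) (xc k + (lam k ν) • y)`
converge to `U s y` at every point of the open lower half space `s < 0`, `U` is an ancient mild
solution at unit viscosity (duality class `IsAncientMildSolution 1 U`), its negative-time slices
are (a.e. strongly) measurable, and `U` is not a.e. trivial.

The proof is the tree's Type-I zoom kit (Koch–Nadirashvili–Seregin–Šverák 2009 §6 rescaling about
Leray near-maximum points; `Literature.Analysis.NavierStokesZoomKit`, the Literature re-homing of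
the cell's `SqueezeCycleSingularZoom*` / `ScaledTopAlignmentTypeIZoom*` modules) read for the
VELOCITY instead of the vorticity:

1. sub-slab bounds `‖u‖ ≤ M(T₁)` on `[0, T₁] × ℝ³`, `T₁ < T`, from the rapid decay of the datum and
   the Leray–Hopf energy bound (`exists_forall_norm_le_of_tao2011` with the discharged
   `tao2011_hasBoundedSobolevNormsOn_holds`);
2. Leray's necessary rate at near-maximum points (`exists_lerayRate_points`, over the tree theorem
   `leray_blowup_rate_top_holds`) and the global Type-I rate `√(T − t)‖u(t, x)‖ ≤ C₁`
   (`exists_global_typeI_rate`);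
3. the zooms `w_k = (c_k α) • u ∘ Φ_k`, `Φ_k(s, y) = (T + c_k² β s, x_k + c_k R y)`, `R = √(νT)`,
   `α = R/ν`, `β = R²/ν = T`, `c_k = 1/(k+2)`, about the FIXED final time `T` and the MOVING
   near-maximum centres `x_k` of `u(T − c_k² T)`: classical unit-viscosity Oseen-mild fields on the
   windows `(−(k+2)², 0)` with the common bound `(αC₁/√β)/√(−s)` (`zoom_continuousOn`,
   `zoom_isWeaklyDivFree`, `zoom_oseen_of_slab`, `zoom_norm_le`) and `‖w_k(−1, 0)‖ ≥ c₀/2`;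
4. KNSS Lemma 6.1 / Prop. 4.1 compactness in the tree's form `exists_tendsto_of_typeI_seq_Ioo`:
   along a subsequence the zooms converge pointwise on `s < 0` to a Type-I ancient mild field `W`
   (`IsTypeIAncientMild C W`), hence `‖W(−1, 0)‖ ≥ c₀/2 > 0`;
5. packaging: `lam j = c_{φ j} α` (so `lam² ν = c² β`, `lam ν = c R`), `IsAncientMildSolution 1 W`
   by `IsTypeIAncientMild.isAncientMildSolution`, measurable slices by joint smoothness, and
   non-triviality because a continuous slice which vanishes a.e. vanishes identically
   (`Continuous.ae_eq_iff_eq`, Lebesgue measure is positive on opens).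

No new definitions.  Sources: KochNadirashviliSereginSverak2009 (§6, Lemma 6.1, Prop. 6.1, arXiv
pp. 11–13); SereginSverak2009 §1; GigaMiura2011 §2.1; Leray1934 §19–20; Tao2011 (Cor. 11.1).
-/

set_option linter.dupNamespace false

noncomputable section

open Literature.Analysis Literature.Analysis.FluidPDE Literature.Analysis.NavierStokesZoomKit
open MeasureTheory Set Function Filter Topology

namespace Summit.NavierStokesRegularity.NavierStokesRegularity.Theorems.TypeITangentFlow

/-- **The Type-I vertex zoom limit with moving centres, velocity form.** For `ν > 0`, `T > 0`, a
classical solution `(u, p)` on `ℝ³ × [0, T)`, Leray–Hopf from `u 0`, bounded on every closed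
sub-strip `[0, T₁] × ℝ³` (`T₁ < T`), with the Type-I rate at `T` and no smooth extension past `T`:
there are `C`, a Type-I ancient mild field `W` (`IsTypeIAncientMild C W`) with `W(−1, 0) ≠ 0`,
centres `xc k` and scales `lam k > 0`, `lam k → 0`, such that for every `s < 0` and every `y`
`lam k • u (T + lam k² ν s) (xc k + (lam k ν) • y) → W s y` (KNSS 2009 §6 rescaling about Leray
near-maximum points at the times `T − T/(k+2)²`, compactness `exists_tendsto_of_typeI_seq_Ioo`,
non-triviality from Leray's rate; the velocity twin of the tree's `typeIZoom_ancientMild_limit`). -/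
theorem typeIZoom_velocity_limit {ν T : ℝ} (hν : 0 < ν) (hT : 0 < T)
    {u : ℝ → EuclideanSpace ℝ (Fin 3) → EuclideanSpace ℝ (Fin 3)}
    {p : ℝ → EuclideanSpace ℝ (Fin 3) → ℝ}
    (hsol : IsClassicalNSSolutionOn (Ico 0 T) ν 0 u p) (hLH : IsLerayHopfOn T ν 0 (u 0) u)
    (hbdd : ∀ T₁ ∈ Ioo 0 T, ∃ M : ℝ, ∀ t ∈ Icc 0 T₁, ∀ x, ‖u t x‖ ≤ M)
    (hI : IsTypeIBlowup u T) (hext : ¬ HasSmoothExtensionPast ν 0 u T) :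
    ∃ (C : ℝ) (W : ℝ → EuclideanSpace ℝ (Fin 3) → EuclideanSpace ℝ (Fin 3))
      (xc : ℕ → EuclideanSpace ℝ (Fin 3)) (lam : ℕ → ℝ),
      IsTypeIAncientMild C W ∧ W (-1) 0 ≠ 0 ∧ (∀ k, 0 < lam k) ∧ Tendsto lam atTop (𝓝 0) ∧
      ∀ s : ℝ, s < 0 → ∀ y : EuclideanSpace ℝ (Fin 3),
        Tendsto (fun k : ℕ => lam k • u (T + lam k ^ 2 * ν * s) (xc k + (lam k * ν) • y)) atTop
          (𝓝 (W s y)) := by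
  -- Steps 1–2: Leray points and the global rate
  obtain ⟨c₀, hc₀, hlow⟩ := exists_lerayRate_points hν hT hsol hLH hbdd hext
  obtain ⟨C₁, hrate⟩ := exists_global_typeI_rate (u := u) hT hbdd hI
  -- Step 3: scales `R = √(νT)`, `α = R/ν`, `β = R²/ν = T`, `c_k = 1/(k+2)`
  set R : ℝ := Real.sqrt (ν * T) with hRdef
  have hR : 0 < R := Real.sqrt_pos.2 (mul_pos hν hT)
  set α : ℝ := R / ν with hα
  set β : ℝ := R ^ 2 / ν with hβ
  have hν0 : ν ≠ 0 := hν.ne'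
  have hR2 : R ^ 2 = ν * T := by rw [hRdef, Real.sq_sqrt (mul_pos hν hT).le]
  have hβT : β = T := by rw [hβ, hR2]; field_simp
  have hβpos : 0 < β := by rw [hβT]; exact hT
  have hαpos : 0 < α := by rw [hα]; positivity
  set c : ℕ → ℝ := fun k => 1 / ((k : ℝ) + 2) with hcdef
  have hc : ∀ k, 0 < c k := fun k => by rw [hcdef]; positivity
  have hc0 : Tendsto c atTop (𝓝 0) := by
    have h := (tendsto_one_div_add_atTop_nhds_zero_nat (𝕜 := ℝ)).comp (tendsto_add_atTop_nat 1)
    refine h.congr fun k => ?_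
    simp only [hcdef, comp_apply, Nat.cast_add, Nat.cast_one]
    ring
  -- the windows `(A k, 0)`, `A k = -(T/(c_k² β)) = -(k+2)²`
  set A : ℕ → ℝ := fun k => -(T / (c k ^ 2 * β)) with hAdef
  have hAk : ∀ k, A k = -(((k : ℝ) + 2) ^ 2) := fun k => by
    simp only [hAdef, hcdef, hβT]
    field_simp
  have hA : Tendsto A atTop atBot := by
    have h1 : Tendsto (fun k : ℕ => ((k : ℝ) + 2) ^ 2) atTop atTop := by
      refine tendsto_atTop_mono (fun k => ?_)
        (tendsto_atTop_add_const_right _ 2 tendsto_natCast_atTop_atTop)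
      nlinarith [(Nat.cast_nonneg k : (0 : ℝ) ≤ k)]
    exact (tendsto_neg_atTop_atBot.comp h1).congr fun k => (hAk k).symm
  -- `-1` lies in every window
  have hm1 : ∀ k, (-1 : ℝ) ∈ Ioo (-(T / (c k ^ 2 * β))) 0 := fun k => by
    refine ⟨?_, by norm_num⟩
    show A k < -1
    rw [hAk]
    nlinarith [(Nat.cast_nonneg k : (0 : ℝ) ≤ k)]
  -- the near-maximum centres at the times `t_k = T - c_k² β`
  set tk : ℕ → ℝ := fun k => T + c k ^ 2 * β * (-1) with htkdef
  have htk : ∀ k, tk k ∈ Ico 0 T := fun k =>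
    (zoom_time_mem (T := T) (hc k) hβpos le_rfl (hm1 k)).2
  choose xk hxk using fun k => hlow (tk k) (htk k)
  -- the zooms
  set w : ℕ → ℝ → EuclideanSpace ℝ (Fin 3) → EuclideanSpace ℝ (Fin 3) :=
    fun k => (c k * α) • stPull (c k ^ 2 * β) (c k * R) T (xk k) u with hwdef
  have hcw : ∀ k, ContinuousOn (uncurry (w k)) (Ioo (A k) 0 ×ˢ univ) := fun k =>
    zoom_continuousOn (x₀ := xk k) hν hsol hR hα hβ (hc k) le_rfl
  have hdivw : ∀ k, ∀ t ∈ Ioo (A k) 0, IsWeaklyDivFree (w k t) := fun k t ht =>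
    zoom_isWeaklyDivFree (x₀ := xk k) hν hsol hR hα hβ (hc k) le_rfl ht
  have hmild : ∀ k, ∀ s t : ℝ, A k < s → s < t → t < 0 → ∀ x,
      w k t x = UnboundedOperators.heatExtension (w k s) (t - s) x -
        oseenDuhamel 1 s (w k) (w k) t x := fun k s t hs hst ht x =>
    zoom_oseen_of_slab (x₀ := xk k) hν hT hsol hLH hbdd hR hα hβ (hc k) le_rfl hs hst ht x
  have hIw : ∀ k, ∀ t ∈ Ioo (A k) 0, ∀ x, ‖w k t x‖ ≤ (α * C₁ / Real.sqrt β) / Real.sqrt (-t) :=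
    fun k t ht x =>
      zoom_norm_le (T := T) (x₀ := xk k) (u := u) hR hα hβ hν (hc k) le_rfl hrate ht x
  -- Step 4: extraction (KNSS Lemma 6.1 / Prop. 4.1 in the tree's form)
  obtain ⟨φ, hφ, W, hW, hpt, -, -, -⟩ :=
    exists_tendsto_of_typeI_seq_Ioo (α * C₁ / Real.sqrt β) hA hcw hdivw hmild hIw
  have hφt : Tendsto φ atTop atTop := hφ.tendsto_atTop
  -- Step 5: non-triviality at `(-1, 0)`
  have hsqrt : ∀ k, Real.sqrt (T - tk k) = c k * Real.sqrt T := fun k => by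
    have e : T - tk k = (c k) ^ 2 * T := by simp only [htkdef, hβT]; ring
    rw [e, Real.sqrt_mul (sq_nonneg _), Real.sqrt_sq (hc k).le]
  have hkey : ∀ k, c k * α * (c₀ * Real.sqrt ν / Real.sqrt (T - tk k) / 2) = c₀ / 2 := fun k => by
    rw [hsqrt k, hα, hRdef, Real.sqrt_mul hν.le]
    have hsν : Real.sqrt ν ≠ 0 := (Real.sqrt_pos.2 hν).ne'
    have hsT : Real.sqrt T ≠ 0 := (Real.sqrt_pos.2 hT).ne'
    have hck : c k ≠ 0 := (hc k).ne'
    have e1 : Real.sqrt ν * Real.sqrt T / ν = Real.sqrt T / Real.sqrt ν := by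
      rw [div_eq_div_iff hν0 hsν]
      calc Real.sqrt ν * Real.sqrt T * Real.sqrt ν
          = Real.sqrt T * (Real.sqrt ν * Real.sqrt ν) := by ring
        _ = Real.sqrt T * ν := by rw [Real.mul_self_sqrt hν.le]
    rw [e1]
    field_simp
  have hwk : ∀ k, c₀ / 2 ≤ ‖w k (-1) 0‖ := fun k => by
    have e : w k (-1) 0 = (c k * α) • u (tk k) (xk k) := by
      simp only [hwdef, smul_stPull_apply, smul_zero, add_zero, htkdef]
    rw [e, norm_smul, Real.norm_of_nonneg (by positivity : (0 : ℝ) ≤ c k * α), ← hkey k]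
    exact mul_le_mul_of_nonneg_left (hxk k) (by positivity)
  have hW0 : W (-1) 0 ≠ 0 := by
    have hlim : c₀ / 2 ≤ ‖W (-1) 0‖ :=
      ge_of_tendsto' ((hpt (-1) (by norm_num) 0).norm) fun j => hwk (φ j)
    intro h
    rw [h, norm_zero] at hlim
    linarith
  -- Step 6: packaging with `lam j = c (φ j) α`, `xc j = x (φ j)`
  refine ⟨α * C₁ / Real.sqrt β, W, fun j => xk (φ j), fun j => c (φ j) * α, hW, hW0,
    fun j => mul_pos (hc (φ j)) hαpos, ?_, fun s hs y => ?_⟩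
  · have h := ((hc0.comp hφt).mul_const α)
    rw [zero_mul] at h
    exact h.congr fun j => rfl
  · have key : ∀ j, (c (φ j) * α) • u (T + (c (φ j) * α) ^ 2 * ν * s)
        (xk (φ j) + (c (φ j) * α * ν) • y) = w (φ j) s y := fun j => by
      have e1 : (c (φ j) * α) ^ 2 * ν = c (φ j) ^ 2 * β := by
        rw [hα, hβ]; field_simp
      have e2 : c (φ j) * α * ν = c (φ j) * R := by
        rw [hα]; field_simp
      simp only [hwdef, smul_stPull_apply, e1, e2]
    exact (hpt s hs y).congr fun j => (key j).symm

/-- **TAN holds** (item stmt-NavierStokesRegularity-29914): proof of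
`Theses.RootDecompPointVertex.TypeITangentFlow`.  A maximal smooth solution is classical on
`[0, T)` without smooth extension past `T`; with a rapidly decaying Leray–Hopf datum it is bounded
on every closed sub-strip (`exists_forall_norm_le_of_tao2011`); `typeIZoom_velocity_limit` gives
the vertex zoom limit `W` with `W(−1, 0) ≠ 0`; `W` is an ancient mild solution at unit viscosity
(`IsTypeIAncientMild.isAncientMildSolution`) with continuous, hence measurable, negative-time
slices, and the continuous slice `W(−1)` is not a.e. zero. -/
theorem typeITangentFlow_proof : Theses.RootDecompPointVertex.TypeITangentFlow := by
  intro ν T hν hT u p hmax hLH hdec hI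
  have hsol : IsClassicalNSSolutionOn (Ico 0 T) ν 0 u p := hmax.1
  have hext : ¬ HasSmoothExtensionPast ν 0 u T := hmax.2
  have hbdd : ∀ T₁ ∈ Ioo 0 T, ∃ M : ℝ, ∀ t ∈ Icc 0 T₁, ∀ x, ‖u t x‖ ≤ M :=
    exists_forall_norm_le_of_tao2011 tao2011_hasBoundedSobolevNormsOn_holds hν hsol hLH hdec
  obtain ⟨C, W, xc, lam, hW, hW0, hlam, hlam0, hconv⟩ :=
    typeIZoom_velocity_limit hν hT hsol hLH hbdd hI hext
  have hWc : ContinuousOn (uncurry W) (Iio 0 ×ˢ univ) := hW.1.continuousOn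
  have hslice : ∀ t : ℝ, t < 0 → Continuous (W t) := fun t ht =>
    hWc.comp_continuous (Continuous.prodMk_right t) fun x => ⟨ht, mem_univ x⟩
  refine ⟨W, ⟨xc, lam, hlam, hlam0, hconv⟩, hW.isAncientMildSolution,
    fun t ht => (hslice t ht).aestronglyMeasurable, fun h => hW0 ?_⟩
  have heq : W (-1) = 0 :=
    (Continuous.ae_eq_iff_eq volume (hslice (-1) (by norm_num)) continuous_zero).1
      (h (-1) (by norm_num))
  rw [heq, Pi.zero_apply]

end Summit.NavierStokesRegularity.NavierStokesRegularity.Theorems.TypeITangentFlow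

end
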